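import Literature.Computability.AlgebraicComplexity.KIReductionValid
import Literature.Computability.AlgebraicComplexity.PermanentGraphNSUBEXP
import Literature.Computability.Complexity.NSubexpKarpProofs
import Literature.Computability.Complexity.PolyExistsNTIME
import HarnessLib

/-!
# Kabanets–Impagliazzo, Cor. 12: discharge of the reduction fact and of Cor. 12

Last file of the discharge of
`Literature.Computability.AlgebraicComplexity.permanent01Graph_polyExists_preimage_PIT`
(`PermanentGraphNSUBEXP.lean`) and of
`Literature.Computability.AlgebraicComplexity.permanent01Graph_mem_NSUBEXP_of_PIT`
(`ValiantBooleanBridgeProofs.lean`; Kabanets–Impagliazzo 2003, Lemma 11 and Cor. 12, p. 358):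

* **`permanent01Graph_polyExists_preimage_PIT_holds`** — the reduction is `kiRed`
  (`KIReductionValid.lean`, in `FP` by `kiRed_mem_FP`); completeness by `exists_good_blocks`
  (`KIReductionCorrectness.lean`) with the honest guess `encBlocks` (`KIReductionCodes.lean`, of
  polynomial length), soundness by `kiCircuit_sound` for every guess and `badWord ∉ PITLanguage`
  for non-canonical inputs;
* **`permanent01Graph_mem_NSUBEXP_of_PIT_holds`** — Cor. 12, by
  `permanent01Graph_mem_NSUBEXP_of_PIT_of_facts` from the three discharged ingredients: the
  reduction (this file), the Karp closure `NSUBEXP_of_karpReducible_holds`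
  (`NSubexpKarpProofs.lean`) and the `∃`-closure `polyExists_NSUBEXP_subset_NSUBEXP_holds`
  (`PolyExistsNTIME.lean`).

Deviations of the formal proof from the printed one (all inside the reduction, recorded in
`KIReductionInstance.lean`): the `n + 1` circuits `P₀, …, Pₙ` are guessed separately instead of
one circuit with its restrictions; the identities are combined by a sum of squares over `ℤ`
instead of powers of a fresh variable; the base identity is `P₀ − 1` (the `0 × 0` permanent).

## References

* V. Kabanets, R. Impagliazzo, *Derandomizing polynomial identity tests means proving circuit
  lower bounds*, STOC 2003, Lemma 11 and Cor. 12 (p. 358).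
-/

noncomputable section

namespace Literature.Computability.AlgebraicComplexity

namespace KIReduction

open _root_.Computability Complexity Brick Polynomial ArithCircuit QuantumComplexity

/-! ### Transport and congruence of the instance -/

/-- The levels depend only on the blocks `P 0, …, P i`. [folklore] -/
theorem levels_congr (n : ℕ) {P P' : ℕ → KBlock} (h : ∀ i, i ≤ n → P i = P' i) : ∀ i, i ≤ n → levels n P i = levels n P' i
  | 0, _ => by rw [levels, levels, h 0 (Nat.zero_le n)]
  | i + 1, hi => by rw [levels, levels, levels_congr n h i (by omega), h (i + 1) hi, h i (by omega)]

/-- The instance depends only on the blocks `P 0, …, P n`. [folklore] -/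
theorem kiCircuit_congr (n : ℕ) (M : Fin n → Fin n → ℤ) (v : ℤ) {P P' : ℕ → KBlock} (h : ∀ i, i ≤ n → P i = P' i) :
    kiCircuit n M v P = kiCircuit n M v P' := by
  simp only [kiCircuit, levels_congr n h n le_rfl, h n le_rfl]

/-- Transport of the instance along an equality of dimensions. [folklore] -/
theorem kiCircuit_eval_cast {m k : ℕ} (hk : k = m) (M : Fin m → Fin m → ℤ) (M' : Fin k → Fin k → ℤ)
    (h : ∀ a b, M' a b = M (Fin.cast hk a) (Fin.cast hk b)) (v : ℤ) (P : ℕ → KBlock) :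
    (kiCircuit k M' v P).eval = 0 ↔ (kiCircuit m M v P).eval = 0 := by
  subst hk
  have : M' = M := funext fun a => funext fun b => by simpa using h a b
  rw [this]

/-- The permanent of a `0/1` integer matrix is non-negative. [folklore] -/
theorem permanent_nonneg_of_zero_one {m : ℕ} (M : Fin m → Fin m → ℤ) (hM : ∀ a b, M a b = 0 ∨ M a b = 1) :
    0 ≤ (Matrix.of M).permanent := by
  unfold Matrix.permanent
  refine Finset.sum_nonneg fun σ _ => Finset.prod_nonneg fun i _ => ?_
  rcases hM (σ i) i with h | h <;> simp [Matrix.of_apply, h]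

/-- The dimension is at most the length of the matrix code (private copy of a lemma held outside this
file's import cone: `QuantumComplexity/PermanentSearchRuns.lean`). [folklore] -/
private theorem le_length_encode_matrix {m : ℕ} (M : Fin m → Fin m → ℤ) : m ≤ (encodingIntMatrix.encode ⟨m, M⟩).length := by
  rw [BosonCodes.encode_matrix_eq, length_boolPair, length_boolPair, KIReduction.length_ones']; omega

/-! ### The discharge -/

/-- The witness-length polynomial for exponent `c`: `(X+1)(2(s(6(X² + s) + 58)) + 2)`, `s = X^c + c + 1`. [folklore] -/
def witnessPoly (c : ℕ) : Polynomial ℕ :=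
  (X + 1) * (2 * ((X ^ c + Polynomial.C c + 1) * (6 * (X ^ 2 + (X ^ c + Polynomial.C c + 1)) + 58)) + 2)

/-- **Discharge of the reduction fact** (Kabanets–Impagliazzo 2003, Lemma 11 with the guessing
step of the proof of Cor. 12): under p-bounded constant-free circuits for `(PER_n)`, `kiRed ∈ FP`
and a polynomial witness bound present `permanent01Graph` as `∃ y, |y| ≤ p |x| ∧ kiRed ⟨x, y⟩ ∈ PIT`.
[cite: KabanetsImpagliazzo2003, Lemma 11 and proof of Cor. 12 (p. 358)] -/
theorem permanent01Graph_polyExists_preimage_PIT_holds : permanent01Graph_polyExists_preimage_PIT := by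
  rintro ⟨c, hc⟩
  refine ⟨kiRed, kiRed_mem_FP, witnessPoly c, fun x => ⟨?_, ?_⟩⟩
  · -- completeness
    rintro ⟨m, M, hM, rfl⟩
    obtain ⟨P, hlen, hidx, hzero⟩ := exists_good_blocks m hc
    set v := ((Matrix.of M).permanent).toNat with hv
    set Ps : List KBlock := (List.range (m + 1)).map P with hPs
    have hPi : ∀ i, i ≤ m → Ps.getD i [] = P i := fun i hi => by
      rw [hPs, List.getD_eq_getElem?_getD, List.getElem?_map, List.getElem?_range (Nat.lt_succ_of_le hi)]; rfl
    refine ⟨encBlocks Ps, ?_, ?_⟩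
    · -- the witness is short
      have hs : ∀ B ∈ Ps, B.length ≤ m ^ c + c + 1 := by
        intro B hB
        rw [hPs, List.mem_map] at hB
        obtain ⟨i, hi, rfl⟩ := hB
        rw [List.mem_range] at hi
        exact (hlen i).trans (by have := Nat.pow_le_pow_left (Nat.le_of_lt_succ hi) c; omega)
      have hI : ∀ B ∈ Ps, ∀ g ∈ B, g.a.idx < m * m + B.length ∧ g.b.idx < m * m + B.length := by
        intro B hB g hg
        rw [hPs, List.mem_map] at hB
        obtain ⟨i, -, rfl⟩ := hB
        exact hidx i g hg
      refine (length_encBlocks_le hs hI).trans ?_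
      have hm := le_length_encode_matrix M
      set L := (boolPair (encodingIntMatrix.encode ⟨m, M⟩) (encodeNat v)).length with hL
      have hmL : m ≤ L := hm.trans (by rw [hL, length_boolPair]; omega)
      have hPl : Ps.length = m + 1 := by rw [hPs, List.length_map, List.length_range]
      simp only [hPl, witnessPoly, Polynomial.eval_mul, Polynomial.eval_add, Polynomial.eval_pow, Polynomial.eval_X,
        Polynomial.eval_C, Polynomial.eval_ofNat, Polynomial.eval_one]
      have h1 : m ^ c ≤ L ^ c := Nat.pow_le_pow_left hmL c
      have h2 : m * m ≤ L ^ 2 := by rw [pow_two]; exact Nat.mul_le_mul hmL hmL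
      have h3 : m ^ c + c + 1 ≤ L ^ c + c + 1 := by omega
      have h4 : 6 * (m * m + (m ^ c + c + 1)) + 58 ≤ 6 * (L ^ 2 + (L ^ c + c + 1)) + 58 := by omega
      exact Nat.mul_le_mul (by omega) (Nat.add_le_add_right (Nat.mul_le_mul_left 2 (Nat.mul_le_mul h3 h4)) 2)
    · -- the instance vanishes
      obtain ⟨M', hm', hMM', hred⟩ := kiRed_canonical M hM v (encBlocks Ps)
      rw [hred, circuitWord_mem_PITLanguage, kiCircuit_eval_cast hm' M M' hMM',
        kiCircuit_congr m M _ (P' := P) (fun i hi => by rw [readBlocks_encBlocks, hPi i hi])]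
      have hvz : ((v : ℕ) : ℤ) = (Matrix.of M).permanent := by
        rw [hv, Int.toNat_of_nonneg (permanent_nonneg_of_zero_one M hM)]
      rw [hvz]
      exact hzero M
  · -- soundness
    rintro ⟨y, -, hy⟩
    by_cases hval : fstF (boolPair x y) = canonX (boolPair x y)
    · rw [kiRed_apply, if_pos hval, circuitWord_mem_PITLanguage] at hy
      have hs := kiCircuit_sound _ _ _ _ hy
      rw [fstF_boolPair] at hval
      rw [hval, canonX]
      refine ⟨_, parsedM (boolPair x y), parsedM_zero_one _, ?_⟩
      rw [← hs, Int.toNat_natCast]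
    · exact absurd (kiRed_of_ne hval ▸ hy) badWord_not_mem_PITLanguage

end KIReduction

/-- **Kabanets–Impagliazzo 2003, Cor. 12 (discharged)**: if `PIT ∈ NSUBEXP` and the permanent
has p-bounded constant-free arithmetic circuits then the `0/1` permanent (as its graph language) is
in `NSUBEXP` — guess the circuits, reduce to one identity test (`permanent01Graph_polyExists_preimage_PIT_holds`),
and close `NSUBEXP` under the Karp reduction (`NSUBEXP_of_karpReducible_holds`) and the polynomially
bounded `∃` (`polyExists_NSUBEXP_subset_NSUBEXP_holds`). [cite: KabanetsImpagliazzo2003, Cor. 12 (p. 358)] -/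
theorem permanent01Graph_mem_NSUBEXP_of_PIT_holds : permanent01Graph_mem_NSUBEXP_of_PIT :=
  permanent01Graph_mem_NSUBEXP_of_PIT_of_facts KIReduction.permanent01Graph_polyExists_preimage_PIT_holds
    Complexity.NSUBEXP_of_karpReducible_holds Complexity.polyExists_NSUBEXP_subset_NSUBEXP_holds

end Literature.Computability.AlgebraicComplexity

end
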